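import Summits.Ventures.YMGap.RobustBall.PlaquetteUpperMomentTilt
import Summits.Ventures.YMGap.RobustBall.PlaquetteCrossTerms
import HarnessLib

/-!
# Venture YMGap, track ROBUST-BALL — the plaquette first moment from ABOVE, II: every DLR state

HONEST FRAMING. WHAT THIS IS: a venture file (cell `pub-ymgap`, track Y2, seat rb-p2 g6): LATTICE
statements about Wilson's `SU(N)` lattice gauge theory on `ℤ^d` (DLR description `ymSpecification`,
tree coupling `β`, weight `exp(-β S_W)`), valid at EVERY `β ≥ 0`, for every DLR state. WHAT IT IS NOT:
nothing about the continuum limit, a spectral gap, or a Clay-sense mass gap.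

MAIN RESULT (`integral_sum_plaquetteObs_le`). For `G ≅ SU(N)` (`IsSpecialUnitaryModel ρ`), `N ≥ 2`,
`d ≥ 2`, every `β ≥ 0`, every Gibbs measure `μ` of the Wilson specification and every link `e`,
writing `D = 4(d-1)Nβ` and `V₀ = ∫_G (Re tr ρ)² dHaar`:

  `∫ ∑_{p ∋ e} Re tr ρ(U_p) dμ ≤ 2(d-1) · β e^{D} V₀ · (1 + (2(d-1) - 1)(e^{D} - 1))`,

the UPPER companion of `PlaquetteFirstMoment.integral_sum_plaquetteObs_ge_sum`: together they say that
the plaquette of every DLR state is `u·e^{O(β)}` with `u = βV₀/N` the exact leading coefficient of the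
strong-coupling series (`PlaquetteLawTwoSided`).

MECHANISM (elementary). (1) Upper source response at the link `e` (part I,
`integral_tilted_sub_integral_le`): `γ_e P_e ≤ β e^{D} Q(η)`, `Q(η) = ∫ (∑_{p∋e} Re tr(ρ(g)ρ(staple_p)))² dg`
(`siteAvg_sum_plaquetteObs_le`). (2) Expanding the square, `Q = 2(d-1)V₀ + ∑_{p ≠ q} C_{pq}` with the
CROSS TERMS `C_{pq}(η) = ∫ Re tr(ρ(g)ρ(staple_p)) Re tr(ρ(g)ρ(staple_q)) dg`, `|C_{pq}| ≤ V₀`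
(file `PlaquetteCrossTerms`: `integral_sq_sum_eq_card_add_cross`, `abs_cross_le`). (3) Resampling the private link of `p`
(`PlaquetteFirstMoment.exists_resampling_link`, privacy `staple_update_eq_of_ne`) by Haar measure
KILLS the cross term, `∫ C_{pq}(η^{f←h}) dh = 0` (`integral_cross_update_eq_zero`), so through the DLR
kernel at `f` (a tilt of oscillation `≤ D`, part I `abs_integral_tilted_le_of_integral_eq_zero`)
`|γ_f C_{pq}| ≤ V₀ (e^{D} - 1)` and, by the DLR equation, `∫ C_{pq} dμ ≤ V₀(e^{D} - 1)`
(`integral_cross_le`).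

References: E. Seiler, LNP 159 (1982), §2; H.-O. Georgii (2011), Remark 1.24. Everything here is
proved; no definition, no named fact. [folklore]
-/

noncomputable section

open MeasureTheory Filter Topology Finset
open Literature.Probability.LatticeModels Literature.Probability.LatticeModels.DobrushinMetric
open Literature.MathematicalPhysics.QuantumLattice Literature.MathematicalPhysics.QuantumFieldTheory

namespace Summit.Ventures.YMGap.RobustBall

namespace PlaquetteUpperMoment

open PlaquettePositivity PlaquetteFirstMoment PlaquetteCrossTerms

/-! ### Part C — through the DLR kernels: the cross terms are `O(e^{D} - 1)`, the source response from above -/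

section Kernel

variable {d N : ℕ} {G : Type*} [Group G] [TopologicalSpace G] [IsTopologicalGroup G]
  [CompactSpace G] [MeasurableSpace G] [BorelSpace G] [SecondCountableTopology G] [T2Space G]
  (ρ : G →* Matrix (Fin N) (Fin N) ℂ)

/-- **Upper source response at one link.** For every boundary condition `ω`, the one-link kernel of
the Wilson specification at `e` gives the plaquette sum `P_e = ∑_{p ∋ e} Re tr ρ(U_p)` a mean at most
`β e^{2βM} ∫ P_e(g | ω)² dg`, `M = N #{p ∋ e}` (Haar mean zero + `integral_tilted_sub_integral_le`).
[folklore] -/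
theorem siteAvg_sum_plaquetteObs_le (hρ : IsSpecialUnitaryModel ρ) (hN : 2 ≤ N) {β : ℝ}
    (hβ : 0 ≤ β) (e : Literature.MathematicalPhysics.QuantumLattice.ZdEdge d) (ω : LGConfig d G) :
    siteAvg (ymSpecification ρ β) e
        (fun U => ∑ p ∈ plaquettesTouching {e}, plaquetteObs ρ p.1 p.2.1.1 p.2.1.2 U) ω ≤
      β * Real.exp (2 * β * ((plaquettesTouching {e}).card * N)) *
        ∫ g, (∑ p ∈ plaquettesTouching {e}, (ρ g * ρ (staple p e ω)).trace.re) ^ 2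
          ∂haarProbability G := by
  have hu := IsSpecialUnitaryModel.mem_unitaryGroup ρ hρ
  have hγ := isSpecification_ymSpecification_of_t2Space (d := d) ρ hρ.1 β
  have hPm : Measurable fun U : LGConfig d G =>
      ∑ p ∈ plaquettesTouching {e}, plaquetteObs ρ p.1 p.2.1.1 p.2.1.2 U :=
    Finset.measurable_sum _ fun p _ => (continuous_plaquetteObs ρ hρ.1 _ _ _).measurable
  rw [siteAvg_eq_integral_siteLaw hγ e hPm ω]
  simp_rw [sum_plaquetteObs_update ρ hu e ω]
  rw [siteLaw_eq_tilted_sum ρ hρ.1 hu β e ω]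
  set R : G → ℝ := fun g => ∑ p ∈ plaquettesTouching {e}, (ρ g * ρ (staple p e ω)).trace.re
    with hR
  have hRm : Measurable R := (continuous_sum_re_trace_staple ρ hρ.1 e ω).measurable
  have hRb : ∀ g, |R g| ≤ (plaquettesTouching {e}).card * N := abs_sum_re_trace_staple_le ρ hu e ω
  have key := integral_tilted_sub_integral_le (μ := haarProbability G) hRm hRb hβ
  have hmean : ∫ g, R g ∂haarProbability G = 0 := integral_sum_re_trace_staple_eq_zero ρ hρ hN e ω
  rw [hmean] at key
  simp only [sub_zero] at key
  exact key

/-- **The cross term through the DLR kernel at the private link**: with `p, q, f` as in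
`integral_cross_update_eq_zero`, for every boundary condition `η`,
`|γ_f C_{pq} (η)| ≤ V₀ (e^{2βN #{r ∋ f}} - 1)` (a tilt of oscillation `≤ 2βN #{r ∋ f}` of Haar measure,
under which the cross term has mean zero). [folklore] -/
theorem abs_siteAvg_cross_le (hρ : IsSpecialUnitaryModel ρ) (hN : 2 ≤ N) {β : ℝ} (hβ : 0 ≤ β)
    {e f : Literature.MathematicalPhysics.QuantumLattice.ZdEdge d} {p q : ZdPlaquette d}
    (hep : e ∈ plaquetteEdges p) (hfp : f ∈ plaquetteEdges p) (hfe : f ≠ e)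
    (heq : e ∈ plaquetteEdges q) (hqp : q ≠ p)
    (hst : ∀ ω : LGConfig d G, ∃ a b : G, ∀ h : G, staple p e (Function.update ω f h) = a * h * b)
    (η : LGConfig d G) :
    |siteAvg (ymSpecification ρ β) f
        (fun η' : LGConfig d G => ∫ g, (ρ g * ρ (staple p e η')).trace.re *
          (ρ g * ρ (staple q e η')).trace.re ∂haarProbability G) η| ≤
      PlaquetteLowerBound.charVariance ρ *
        (Real.exp (β * (2 * N * (plaquettesTouching {f}).card)) - 1) := by
  have hu := IsSpecialUnitaryModel.mem_unitaryGroup ρ hρ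
  have hγ := isSpecification_ymSpecification_of_t2Space (d := d) ρ hρ.1 β
  set C : LGConfig d G → ℝ := fun η' => ∫ g, (ρ g * ρ (staple p e η')).trace.re *
    (ρ g * ρ (staple q e η')).trace.re ∂haarProbability G with hC
  have hCm : Measurable C := measurable_cross ρ hρ.1 p q e
  rw [siteAvg_eq_integral_siteLaw hγ f hCm η, siteLaw_ymSpecification_eq_tilted_haar ρ hρ.1 β f η]
  set D : ℝ := β * (2 * N * (plaquettesTouching {f}).card) with hD
  have hφm : Measurable fun h : G => -β * wilsonBoundaryAction ρ {f} (Function.update η f h) :=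
    ((continuous_const.mul (continuous_wilsonBoundaryAction ρ hρ.1 {f})).measurable).comp
      (measurable_update η)
  have hφ : ∀ h : G, -D ≤ -β * wilsonBoundaryAction ρ {f} (Function.update η f h) ∧
      -β * wilsonBoundaryAction ρ {f} (Function.update η f h) ≤ -D + D := by
    intro h
    have hb := wilsonBoundaryAction_singleton_mem ρ hu f (Function.update η f h)
    constructor
    · rw [hD]; nlinarith [hb.2]
    · rw [neg_add_cancel]; nlinarith [hb.1]
  obtain ⟨a, b, hab⟩ := hst η
  exact abs_integral_tilted_le_of_integral_eq_zero (ν := haarProbability G)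
    (F := fun h => C (Function.update η f h)) (hCm.comp (measurable_update η))
    (fun h => abs_cross_le ρ hρ.1 p q e _)
    (integral_cross_update_eq_zero ρ hρ hN hep hfp hfe heq hqp η hab) hφm hφ

variable [NeZero d]

omit [NeZero d] in
/-- **Every cross term of a DLR state is `≤ V₀ (e^{D} - 1)`**, `D = 4(d-1)Nβ`: for every Gibbs
measure `μ` of the Wilson specification at `β ≥ 0` (`G ≅ SU(N)`, `N ≥ 2`, `d ≥ 2`), every link `e`
and all plaquettes `p ≠ q` through `e`, `∫ C_{pq} dμ ≤ V₀ (e^{D} - 1)` (DLR equation at the private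
link of `p`). [folklore] -/
theorem integral_cross_le (hρ : IsSpecialUnitaryModel ρ) (hN : 2 ≤ N) (hd : 2 ≤ d) {β : ℝ}
    (hβ : 0 ≤ β) {μ : Measure (LGConfig d G)} (hμ : μ ∈ ymGibbsMeasures ρ β)
    {e : Literature.MathematicalPhysics.QuantumLattice.ZdEdge d} {p q : ZdPlaquette d}
    (hp : p ∈ plaquettesTouching {e}) (hq : q ∈ plaquettesTouching {e}) (hqp : q ≠ p) :
    ∫ η, ∫ g, (ρ g * ρ (staple p e η)).trace.re * (ρ g * ρ (staple q e η)).trace.re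
        ∂haarProbability G ∂μ ≤
      PlaquetteLowerBound.charVariance ρ * (Real.exp (4 * ((d : ℝ) - 1) * N * β) - 1) := by
  classical
  have hγ := isSpecification_ymSpecification_of_t2Space (d := d) ρ hρ.1 β
  have hμG := hμ
  rw [mem_ymGibbsMeasures_iff] at hμG
  haveI := hμG.isProbabilityMeasure
  have hep : e ∈ plaquetteEdges p := mem_plaquettesTouching_singleton.1 hp
  have heq : e ∈ plaquetteEdges q := mem_plaquettesTouching_singleton.1 hq
  obtain ⟨f, hfp, hfe, hst⟩ := exists_resampling_link (G := G) p hep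
  set C : LGConfig d G → ℝ := fun η' => ∫ g, (ρ g * ρ (staple p e η')).trace.re *
    (ρ g * ρ (staple q e η')).trace.re ∂haarProbability G with hC
  have hCm : Measurable C := measurable_cross ρ hρ.1 p q e
  have hCb : ∀ η', |C η'| ≤ PlaquetteLowerBound.charVariance ρ := fun η' => abs_cross_le ρ hρ.1 p q e η'
  have hiC : Integrable C μ :=
    Integrable.of_bound hCm.aestronglyMeasurable _ (ae_of_all _ fun η' => by
      rw [Real.norm_eq_abs]; exact hCb η')
  have hcf : β * (2 * N * (plaquettesTouching {f}).card) = 4 * ((d : ℝ) - 1) * N * β := by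
    have h' : ((plaquettesTouching {f}).card : ℝ) = 2 * ((d : ℝ) - 1) := by
      rw [Balaban1983to89.Sufficient.card_plaquettesTouching_singleton f]
      have h1 : 1 ≤ d := by omega
      push_cast [Nat.cast_sub h1]
      ring
    rw [h']; ring
  have hker : ∀ η', siteAvg (ymSpecification ρ β) f C η' ≤
      PlaquetteLowerBound.charVariance ρ * (Real.exp (4 * ((d : ℝ) - 1) * N * β) - 1) := fun η' => by
    have h := abs_siteAvg_cross_le ρ hρ hN hβ hep hfp hfe heq hqp hst η'
    rw [hcf] at h
    exact (abs_le.1 h).2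
  rw [← hμG.integral_integral_eq hγ {f} hiC]
  have hsm : Measurable (siteAvg (ymSpecification ρ β) f C) := measurable_siteAvg hγ f hCm
  have hiS : Integrable (siteAvg (ymSpecification ρ β) f C) μ :=
    Integrable.of_bound hsm.aestronglyMeasurable _ (ae_of_all _ fun η' => by
      rw [Real.norm_eq_abs]; exact abs_siteAvg_le hγ f hCb η')
  calc ∫ η', siteAvg (ymSpecification ρ β) f C η' ∂μ
      ≤ ∫ _η', PlaquetteLowerBound.charVariance ρ * (Real.exp (4 * ((d : ℝ) - 1) * N * β) - 1) ∂μ :=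
        integral_mono hiS (integrable_const _) hker
    _ = PlaquetteLowerBound.charVariance ρ * (Real.exp (4 * ((d : ℝ) - 1) * N * β) - 1) := by
        simp

omit [NeZero d] in
/-- **THE PLAQUETTE SUM THROUGH A LINK, FROM ABOVE.** For every Gibbs measure `μ` of the Wilson
specification at `β ≥ 0` (`G ≅ SU(N)`, `N ≥ 2`, `d ≥ 2`) and every link `e`, with `D = 4(d-1)Nβ`:
`∫ ∑_{p ∋ e} Re tr ρ(U_p) dμ ≤ β e^{D} V₀ · 2(d-1) · (1 + (2(d-1) - 1)(e^{D} - 1))`. [folklore] -/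
theorem integral_sum_plaquetteObs_le (hρ : IsSpecialUnitaryModel ρ) (hN : 2 ≤ N) (hd : 2 ≤ d)
    {β : ℝ} (hβ : 0 ≤ β) {μ : Measure (LGConfig d G)} (hμ : μ ∈ ymGibbsMeasures ρ β)
    (e : Literature.MathematicalPhysics.QuantumLattice.ZdEdge d) :
    ∫ U, ∑ p ∈ plaquettesTouching {e}, plaquetteObs ρ p.1 p.2.1.1 p.2.1.2 U ∂μ ≤
      β * Real.exp (4 * ((d : ℝ) - 1) * N * β) * PlaquetteLowerBound.charVariance ρ *
        (2 * ((d : ℝ) - 1)) *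
          (1 + (2 * ((d : ℝ) - 1) - 1) * (Real.exp (4 * ((d : ℝ) - 1) * N * β) - 1)) := by
  classical
  have hu := IsSpecialUnitaryModel.mem_unitaryGroup ρ hρ
  have hγ := isSpecification_ymSpecification_of_t2Space (d := d) ρ hρ.1 β
  have hμG := hμ
  rw [mem_ymGibbsMeasures_iff] at hμG
  haveI := hμG.isProbabilityMeasure
  set T := plaquettesTouching {e} with hT
  set D : ℝ := 4 * ((d : ℝ) - 1) * N * β with hDdef
  set V : ℝ := PlaquetteLowerBound.charVariance ρ with hVdef
  set Q : LGConfig d G → ℝ := fun η' =>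
    ∫ g, (∑ p ∈ T, (ρ g * ρ (staple p e η')).trace.re) ^ 2 ∂haarProbability G with hQ
  set C : ZdPlaquette d → ZdPlaquette d → LGConfig d G → ℝ := fun p q η' =>
    ∫ g, (ρ g * ρ (staple p e η')).trace.re * (ρ g * ρ (staple q e η')).trace.re ∂haarProbability G
    with hC
  set P : LGConfig d G → ℝ := fun U => ∑ p ∈ T, plaquetteObs ρ p.1 p.2.1.1 p.2.1.2 U with hP
  have hQm : Measurable Q := measurable_integral_sq_partial_sum ρ hρ.1 e T
  have hPm : Measurable P :=
    Finset.measurable_sum _ fun p _ => (continuous_plaquetteObs ρ hρ.1 _ _ _).measurable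
  set M : ℝ := T.card * N with hM
  have hPb : ∀ U, |P U| ≤ M := fun U => by
    calc |P U| ≤ ∑ p ∈ T, |plaquetteObs ρ p.1 p.2.1.1 p.2.1.2 U| := Finset.abs_sum_le_sum_abs _ _
      _ ≤ ∑ _p ∈ T, (N : ℝ) := Finset.sum_le_sum fun p _ => abs_re_trace_le_of_mem_unitaryGroup (hu _)
      _ = M := by rw [Finset.sum_const, nsmul_eq_mul]
  have hQb : ∀ η', |Q η'| ≤ M ^ 2 := fun η' => by
    rw [abs_of_nonneg (integral_sq_partial_sum_nonneg_le ρ hu e T η').1]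
    exact (integral_sq_partial_sum_nonneg_le ρ hu e T η').2
  have hiP : Integrable P μ :=
    Integrable.of_bound hPm.aestronglyMeasurable M (ae_of_all _ fun U => by
      rw [Real.norm_eq_abs]; exact hPb U)
  have hiQ : Integrable Q μ :=
    Integrable.of_bound hQm.aestronglyMeasurable (M ^ 2) (ae_of_all _ fun η' => by
      rw [Real.norm_eq_abs]; exact hQb η')
  have hCm : ∀ p q, Measurable (C p q) := fun p q => measurable_cross ρ hρ.1 p q e
  have hiC : ∀ p q, Integrable (C p q) μ := fun p q =>
    Integrable.of_bound (hCm p q).aestronglyMeasurable V (ae_of_all _ fun η' => by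
      rw [Real.norm_eq_abs]; exact abs_cross_le ρ hρ.1 p q e η')
  -- counting
  have hce : (T.card : ℝ) = 2 * ((d : ℝ) - 1) := by
    rw [hT, Balaban1983to89.Sufficient.card_plaquettesTouching_singleton e]
    have h1 : 1 ≤ d := by omega
    push_cast [Nat.cast_sub h1]
    ring
  have hexpM : Real.exp (2 * β * M) = Real.exp D := by rw [hM, hce, hDdef]; ring_nf
  -- Step 1: `∫ P dμ ≤ β e^{D} ∫ Q dμ`
  have hP1 : ∫ U, P U ∂μ ≤ β * Real.exp D * ∫ η, Q η ∂μ := by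
    rw [← hμG.integral_integral_eq hγ {e} hiP, ← integral_const_mul]
    have hsm : Measurable (siteAvg (ymSpecification ρ β) e P) := measurable_siteAvg hγ e hPm
    refine integral_mono ?_ (hiQ.const_mul _) fun η => ?_
    · exact Integrable.of_bound hsm.aestronglyMeasurable M (ae_of_all _ fun η => by
        rw [Real.norm_eq_abs]; exact abs_siteAvg_le hγ e hPb η)
    · have h := siteAvg_sum_plaquetteObs_le ρ hρ hN hβ e η
      rw [hexpM] at h
      exact h
  -- Step 2: `∫ Q dμ = #T V₀ + ∑∑ ∫ C`
  have hQexp : Q = fun η' => T.card * V + ∑ p ∈ T, ∑ q ∈ T.erase p, C p q η' := by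
    funext η'
    exact integral_sq_sum_eq_card_add_cross ρ hρ.1 e T η'
  have hintQ : ∫ η, Q η ∂μ = T.card * V + ∑ p ∈ T, ∑ q ∈ T.erase p, ∫ η, C p q η ∂μ := by
    rw [hQexp, integral_add (integrable_const _)
      (integrable_finsetSum _ fun p _ => integrable_finsetSum _ fun q _ => hiC p q)]
    simp only [integral_const, probReal_univ, one_smul]
    congr 1
    rw [integral_finsetSum _ fun p _ => integrable_finsetSum _ fun q _ => hiC p q]
    exact Finset.sum_congr rfl fun p _ => integral_finsetSum _ fun q _ => hiC p q
  -- Step 3: each cross term is `≤ V (e^{D} - 1)`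
  have hcross : ∑ p ∈ T, ∑ q ∈ T.erase p, ∫ η, C p q η ∂μ ≤
      ∑ p ∈ T, ∑ _q ∈ T.erase p, V * (Real.exp D - 1) :=
    Finset.sum_le_sum fun p hp => Finset.sum_le_sum fun q hq =>
      integral_cross_le ρ hρ hN hd hβ hμ hp (Finset.mem_of_mem_erase hq) (Finset.ne_of_mem_erase hq)
  have hcount : ∑ p ∈ T, ∑ _q ∈ T.erase p, V * (Real.exp D - 1) =
      T.card * ((T.card : ℝ) - 1) * (V * (Real.exp D - 1)) := by
    rw [Finset.sum_congr rfl fun p hp => by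
      rw [Finset.sum_const, Finset.card_erase_of_mem hp, nsmul_eq_mul]]
    rw [Finset.sum_const, nsmul_eq_mul]
    have hT1 : 1 ≤ T.card := by
      rw [hT, Balaban1983to89.Sufficient.card_plaquettesTouching_singleton e]; omega
    push_cast [Nat.cast_sub hT1]
    ring
  have hV0 : 0 ≤ V := (PlaquetteLowerBound.charVariance_pos ρ hρ.1 (by omega)).le
  have hβe : 0 ≤ β * Real.exp D := by positivity
  calc ∫ U, P U ∂μ ≤ β * Real.exp D * ∫ η, Q η ∂μ := hP1
    _ = β * Real.exp D * (T.card * V + ∑ p ∈ T, ∑ q ∈ T.erase p, ∫ η, C p q η ∂μ) := by rw [hintQ]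
    _ ≤ β * Real.exp D * (T.card * V + T.card * ((T.card : ℝ) - 1) * (V * (Real.exp D - 1))) := by
        refine mul_le_mul_of_nonneg_left ?_ hβe
        linarith [hcross, hcount]
    _ = β * Real.exp D * V * (2 * ((d : ℝ) - 1)) *
          (1 + (2 * ((d : ℝ) - 1) - 1) * (Real.exp D - 1)) := by rw [hce]; ring

end Kernel

end PlaquetteUpperMoment

end Summit.Ventures.YMGap.RobustBall
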